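import Summits.ResolutionOfSingularities.ResolutionOfSingularities.Theorems.WallFrames12
import Summits.ResolutionOfSingularities.ResolutionOfSingularities.Theorems.NearCutCompanion3
import Summits.ResolutionOfSingularities.ResolutionOfSingularities.Theorems.NearCutWalls2
import Summits.ResolutionOfSingularities.ResolutionOfSingularities.Theorems.ProximityCutArcLaw
import Summits.ResolutionOfSingularities.ResolutionOfSingularities.Theorems.MaxContactCutBoundaryLedger
import Summits.ResolutionOfSingularities.ResolutionOfSingularities.Theorems.MaxContactCutWallCut
import Summits.ResolutionOfSingularities.ResolutionOfSingularities.Theorems.PlanarGhostDescent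
import Literature.AlgebraicGeometry.Resolution.PointBlowupIFPGiraud
import Literature.AlgebraicGeometry.Resolution.AdicNoetherian
import HarnessLib

/-!
# WallFrames (13/17) — Kollár's wall descent in a polynomial frame; sections: Slots (cont.), Steps

Verbatim slice of the farm-checked monolith `WallFrames.lean` of cell `decomp-res`, seat `decomp-res-lens-5`, g35
(sha256 7405a21d81d102a4…, monolith lines 3066–3328); one namespace `Summit.ResolutionOfSingularities.ResolutionOfSingularities.Theorems.WallFrames` across the
slices, imports chained.  The monolith's module docstring (laws W1–W7, mechanism, novelty, honest placement) is
reproduced in slice 1; the main theorem `balancedWallPort_holds : WallCut.BalancedWallPort` (hypothesis-free) and the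
host-route corollary `ecBalancedWallPort_holds` (aside item 27368 of route MaxContactCut) are in slice 16/17.
-/

open MvPolynomial Finset
open scoped BigOperators
open Literature.AlgebraicGeometry.Resolution
open Literature.AlgebraicGeometry.Resolution.Hauser2010
open Literature.AlgebraicGeometry.Resolution.PointBlowup
open Literature.AlgebraicGeometry.Resolution.HauserPerlega2024

namespace Summit.ResolutionOfSingularities.ResolutionOfSingularities.Theorems.WallFrames

variable {σ : Type*} [Fintype σ] [DecidableEq σ] {K : Type*} [Field K]

section Slots

variable {L : Type} [Field L] [DecidableEq L]

/-- **TORIC SLOTS.** [new] -/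
theorem toric_slots {q : ℕ} {s₀ : State (Fin 3) L} (hroot : TightDefectClasses.IsRoot q s₀)
    (W : TightDefectClasses.ForcedWalk q s₀) (N s : ℕ)
    (hshade : ∀ t, N ≤ t → (W.st t).shade = (s : ℕ∞))
    (hbig : ∀ t, N ≤ t → ordZero (W.st t).F ≠ (q : ℕ∞))
    (hbal : ∀ t, N ≤ t → (W.st t).r.degree + 2 * s = 2 * q ∧
      ∃ x, (W.st t).r x = 0 ∧ ∀ y, y ≠ x → (W.st t).r y + s = q)
    (f : ℕ → Fin 3) (hf : ∀ n, (W.st (N + n)).r (f n) = 0) :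
    ∃ (w : ℕ → Bool) (S1 S2 : ℕ → Fin 3),
      (∀ τ, S1 τ ≠ S2 τ ∧ S1 τ ≠ f τ ∧ S2 τ ≠ f τ ∧ (∀ i, i = f τ ∨ i = S1 τ ∨ i = S2 τ) ∧
        (W.st (N + τ)).r (S1 τ) = q - s ∧ (W.st (N + τ)).r (S2 τ) = q - s) ∧
      (∀ τ, ∃ kp ls : Fin 3,
        ((w τ = true ∧ ls = S1 τ ∧ kp = S2 τ ∧ S1 (τ + 1) = W.j (N + τ) ∧ S2 (τ + 1) = S2 τ) ∨
         (w τ = false ∧ ls = S2 τ ∧ kp = S1 τ ∧ S2 (τ + 1) = W.j (N + τ) ∧ S1 (τ + 1) = S1 τ)) ∧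
        kp ≠ W.j (N + τ) ∧ W.b (N + τ) kp = 0 ∧
        ((W.j (N + τ) = ls ∧ f (τ + 1) = f τ ∧ ∀ i, i ≠ f τ → W.b (N + τ) i = 0) ∨
         (W.j (N + τ) = f τ ∧ f (τ + 1) = ls ∧ W.b (N + τ) ls ≠ 0 ∧ ∀ i, i ≠ ls → W.b (N + τ) i = 0))) ∧
      (∀ τ, ProximityCut.StaysOnNewest W (N + τ) → w (τ + 1) ≠ w τ) := by
  classical
  have hsq : s < q := NearCut.lt_of_balanced hroot W N s (hshade N le_rfl) (hbig N le_rfl) (hbal N le_rfl).1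
  have hδ : q - s ≠ 0 := by omega
  have hanat : ∀ m, ∃ k o : Fin 3, k ≠ W.j (N + m) ∧ o ≠ W.j (N + m) ∧ o ≠ k ∧
      (∀ i, i = W.j (N + m) ∨ i = k ∨ i = o) ∧
      (W.st (N + m)).r k = q - s ∧ W.b (N + m) k = 0 ∧ (W.st (N + m + 1)).r k = q - s ∧
      (W.st (N + m + 1)).r (W.j (N + m)) = q - s ∧ (W.st (N + m + 1)).r o = 0 ∧
      (∀ i, i ≠ o → W.b (N + m) i = 0) ∧
      (((W.st (N + m)).r (W.j (N + m)) = q - s ∧ (W.st (N + m)).r o = 0) ∨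
       ((W.st (N + m)).r (W.j (N + m)) = 0 ∧ (W.st (N + m)).r o = q - s ∧ W.b (N + m) o ≠ 0)) := fun m =>
    move_anatomy hroot W (N + m) s (hshade _ (by omega)) (hbig _ (by omega)) (hbal _ (by omega))
      (hbal _ (by omega))
  choose k o hkj hoj hok hcases hrk hbk hrk' hrj' hro' hb hdich using hanat
  -- the free letter after the move is the third index `o`
  have hfo : ∀ m, f (m + 1) = o m := fun m => by
    rcases hcases m (f (m + 1)) with h | h | h
    · exfalso; have h' : (W.st (N + m + 1)).r (f (m + 1)) = 0 := hf (m + 1)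
      rw [h, hrj'] at h'; exact hδ h'
    · exfalso; have h' : (W.st (N + m + 1)).r (f (m + 1)) = 0 := hf (m + 1)
      rw [h, hrk'] at h'; exact hδ h'
    · exact h
  -- the lost wall
  obtain ⟨lost, hlostdef⟩ : ∃ lost : ℕ → Fin 3, ∀ m,
      lost m = if (W.st (N + m)).r (W.j (N + m)) = q - s then W.j (N + m) else o m := ⟨_, fun m => rfl⟩
  have hlost : ∀ m, (W.st (N + m)).r (lost m) = q - s ∧ lost m ≠ k m ∧
      (((W.st (N + m)).r (W.j (N + m)) = q - s ∧ lost m = W.j (N + m) ∧ f m = o m) ∨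
       ((W.st (N + m)).r (W.j (N + m)) = 0 ∧ lost m = o m ∧ f m = W.j (N + m) ∧ W.b (N + m) (o m) ≠ 0)) := by
    intro m
    rcases hdich m with ⟨hrj, hro⟩ | ⟨hrj, hro, hbo⟩
    · have hl : lost m = W.j (N + m) := by rw [hlostdef, if_pos hrj]
      have hfm : f m = o m := by
        rcases hcases m (f m) with h | h | h
        · exfalso; have h' := hf m; rw [h, hrj] at h'; exact hδ h'
        · exfalso; have h' := hf m; rw [h, hrk] at h'; exact hδ h'
        · exact h
      rw [hl]
      exact ⟨hrj, (hkj m).symm, Or.inl ⟨hrj, rfl, hfm⟩⟩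
    · have hl : lost m = o m := by
        rw [hlostdef, if_neg]
        rw [hrj]; exact fun h => hδ h.symm
      have hfm : f m = W.j (N + m) := by
        rcases hcases m (f m) with h | h | h
        · exact h
        · exfalso; have h' := hf m; rw [h, hrk] at h'; exact hδ h'
        · exfalso; have h' := hf m; rw [h, hro] at h'; exact hδ h'
      rw [hl]
      exact ⟨hro, hok m, Or.inr ⟨hrj, rfl, hfm, hbo⟩⟩
  -- walls after the move are `{j, k}`
  have hwall : ∀ m (i : Fin 3), (W.st (N + m + 1)).r i = q - s → i = W.j (N + m) ∨ i = k m := by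
    intro m i hi
    rcases hcases m i with h | h | h
    · exact Or.inl h
    · exact Or.inr h
    · exfalso; rw [h, hro'] at hi; exact hδ hi.symm
  -- the slot recursion
  obtain ⟨P, hP0, hPs⟩ : ∃ P : ℕ → Fin 3 × Fin 3, P 0 = (k 0, lost 0) ∧
      ∀ τ, P (τ + 1) = (if (P τ).1 = lost τ then (W.j (N + τ), k τ) else (k τ, W.j (N + τ))) :=
    ⟨fun τ => Nat.rec (motive := fun _ => Fin 3 × Fin 3) (k 0, lost 0)
      (fun τ Pτ => if Pτ.1 = lost τ then (W.j (N + τ), k τ) else (k τ, W.j (N + τ))) τ, rfl, fun τ => rfl⟩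
  have hinv : ∀ τ, ((P τ).1 = k τ ∧ (P τ).2 = lost τ) ∨ ((P τ).1 = lost τ ∧ (P τ).2 = k τ) := by
    intro τ
    induction τ with
    | zero => left; rw [hP0]; exact ⟨rfl, rfl⟩
    | succ τ ih =>
      have hk1 := hwall τ (k (τ + 1)) (hrk (τ + 1))
      have hl1 := hwall τ (lost (τ + 1)) (hlost (τ + 1)).1
      have hne := (hlost (τ + 1)).2.1
      rw [hPs τ]
      split_ifs with h
      · rcases hk1 with hk1 | hk1
        · rcases hl1 with hl1 | hl1
          · exact absurd (hl1.trans hk1.symm) hne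
          · exact Or.inl ⟨hk1.symm, hl1.symm⟩
        · rcases hl1 with hl1 | hl1
          · exact Or.inr ⟨hl1.symm, hk1.symm⟩
          · exact absurd (hl1.trans hk1.symm) hne
      · rcases hk1 with hk1 | hk1
        · rcases hl1 with hl1 | hl1
          · exact absurd (hl1.trans hk1.symm) hne
          · exact Or.inr ⟨hl1.symm, hk1.symm⟩
        · rcases hl1 with hl1 | hl1
          · exact Or.inl ⟨hk1.symm, hl1.symm⟩
          · exact absurd (hl1.trans hk1.symm) hne
  obtain ⟨w, hw⟩ : ∃ w : ℕ → Bool, ∀ τ, w τ = decide ((P τ).1 = lost τ) := ⟨_, fun _ => rfl⟩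
  obtain ⟨S1, hS1⟩ : ∃ S1 : ℕ → Fin 3, ∀ τ, S1 τ = (P τ).1 := ⟨_, fun _ => rfl⟩
  obtain ⟨S2, hS2⟩ : ∃ S2 : ℕ → Fin 3, ∀ τ, S2 τ = (P τ).2 := ⟨_, fun _ => rfl⟩
  refine ⟨w, S1, S2, ?_, ?_, ?_⟩
  · -- (I) walls and exhaustion
    intro τ
    rw [hS1, hS2]
    obtain ⟨hrl, hlk, hcase⟩ := hlost τ
    have hS : ∀ i, (i = k τ ∨ i = lost τ) → (W.st (N + τ)).r i = q - s := by
      rintro i (h | h)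
      · rw [h]; exact hrk τ
      · rw [h]; exact hrl
    have h1 : (P τ).1 = k τ ∨ (P τ).1 = lost τ := by
      rcases hinv τ with h | h
      · exact Or.inl h.1
      · exact Or.inr h.1
    have h2 : (P τ).2 = k τ ∨ (P τ).2 = lost τ := by
      rcases hinv τ with h | h
      · exact Or.inr h.2
      · exact Or.inl h.2
    have hr1 := hS _ h1
    have hr2 := hS _ h2
    refine ⟨?_, ?_, ?_, ?_, hr1, hr2⟩
    · rcases hinv τ with h | h
      · rw [h.1, h.2]; exact hlk.symm
      · rw [h.1, h.2]; exact hlk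
    · intro h; have h' := hf τ; rw [← h, hr1] at h'; exact hδ h'
    · intro h; have h' := hf τ; rw [← h, hr2] at h'; exact hδ h'
    · intro i
      have hcover : i = f τ ∨ i = k τ ∨ i = lost τ := by
        rcases hcase with ⟨-, hl, hfm⟩ | ⟨-, hl, hfm, -⟩
        · rw [hl, hfm]
          rcases hcases τ i with h | h | h
          · exact Or.inr (Or.inr h)
          · exact Or.inr (Or.inl h)
          · exact Or.inl h
        · rw [hl, hfm]
          exact hcases τ i
      rcases hcover with h | h | h
      · exact Or.inl h
      · rcases hinv τ with h' | h'
        · exact Or.inr (Or.inl (h.trans h'.1.symm))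
        · exact Or.inr (Or.inr (h.trans h'.2.symm))
      · rcases hinv τ with h' | h'
        · exact Or.inr (Or.inr (h.trans h'.2.symm))
        · exact Or.inr (Or.inl (h.trans h'.1.symm))
  · -- (II) the move: kept / lost, slots, centre
    intro τ
    obtain ⟨hrl, hlk, hcase⟩ := hlost τ
    refine ⟨k τ, lost τ, ?_, hkj τ, hbk τ, ?_⟩
    · rw [hw, hS1, hS2, hS1, hS2]
      by_cases h : (P τ).1 = lost τ
      · left
        have h2 : (P τ).2 = k τ := by
          rcases hinv τ with h' | h'
          · exact absurd (h'.1.symm.trans h) hlk.symm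
          · exact h'.2
        refine ⟨decide_eq_true h, h.symm, h2.symm, ?_, ?_⟩
        · rw [hPs τ, if_pos h]
        · rw [hPs τ, if_pos h, h2]
      · right
        have h1 : (P τ).1 = k τ ∧ (P τ).2 = lost τ := by
          rcases hinv τ with h' | h'
          · exact h'
          · exact absurd h'.1 h
        refine ⟨decide_eq_false h, h1.2.symm, h1.1.symm, ?_, ?_⟩
        · rw [hPs τ, if_neg h]
        · rw [hPs τ, if_neg h, h1.1]
    · rcases hcase with ⟨-, hl, hfm⟩ | ⟨-, hl, hfm, hbo⟩
      · left
        refine ⟨hl.symm, (hfo τ).trans hfm.symm, fun i hi => hb τ i ?_⟩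
        rw [← hfm]; exact hi
      · right
        refine ⟨hfm.symm, (hfo τ).trans hl.symm, by rw [hl]; exact hbo, fun i hi => hb τ i ?_⟩
        rw [← hl]; exact hi
  · -- (III) the switch law
    intro τ hstay
    have hsw := lost_of_staysOnNewest W (N + τ) hδ (hkj τ) (hcases τ) (hrj' τ) (hro' τ) (hok (τ + 1))
      (hcases (τ + 1)) (hrk (τ + 1)) (hdich (τ + 1)) hstay
    have hl1 : lost (τ + 1) = k τ := by
      rw [hlostdef]
      rcases hsw.2 with ⟨hr, hj⟩ | ⟨hr, ho⟩
      · have hr₁ : (W.st (N + (τ + 1))).r (W.j (N + (τ + 1))) = q - s := hr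
        rw [if_pos hr₁]; exact hj
      · have hr₁ : (W.st (N + (τ + 1))).r (W.j (N + (τ + 1))) = 0 := hr
        rw [if_neg (by rw [hr₁]; exact fun h => hδ h.symm)]; exact ho
    rw [hw, hw]
    by_cases h : (P τ).1 = lost τ
    · have h1 : (P (τ + 1)).1 = W.j (N + τ) := by rw [hPs τ, if_pos h]
      rw [decide_eq_true h, h1, hl1]
      rw [decide_eq_false (hkj τ).symm]
      exact Bool.false_ne_true
    · have h1 : (P (τ + 1)).1 = k τ := by rw [hPs τ, if_neg h]
      rw [decide_eq_false h, h1, hl1, decide_eq_true rfl]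
      exact fun h => Bool.noConfusion h

end Slots

/-! ## §21 PRESENTATION STEPS, PACKAGED (NEXT-g36 §4): far toolkit, the lost-wall step and the free-chart step

`Far Λ z R` := every monomial of `R` has wall-degree `|d| − d_z ≥ Λ` (written out, no definition).  The two step lemmas
turn a labelled unit-weighted presentation of `zshear z ζ G` (units `U_a(0) ≠ 0`, injective labels, far remainder with
threshold `Λ ≥ s`) into one of the next sheared companion with threshold `Λ − s`, with the EXPLICIT new index map:
lost-wall `n ↦ χ_s^j n` (`chartExponent`), free-chart `n ↦ (n_u, |n| − s, n_z)` in letters `(u, z, v)` = (kept wall, new wall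
`E` = old free letter, new free letter = lost wall). -/

section Steps

omit [Fintype σ] in
/-- `constantCoeff_zshear`: WallFrames (lens-5 g35) computation rule; docstring added by the writer (lint.docstring) [folklore] -/
theorem constantCoeff_zshear {z : σ} {ζ : MvPolynomial σ K} (hζ1 : (1 : ℕ∞) ≤ ordZero ζ) (P : MvPolynomial σ K) :
    constantCoeff (zshear z ζ P) = constantCoeff P := by
  refine constantCoeff_aeval_of_forall (fun i => ?_) P
  by_cases hi : i = z
  · subst hi
    simp only [if_true, map_add, constantCoeff_X, zero_add]
    exact (one_le_ordZero_iff ζ).mp hζ1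
  · simp only [if_neg hi, constantCoeff_X]

omit [Fintype σ] [DecidableEq σ] in
/-- Far parts: smaller thresholds. [folklore] -/
theorem far_mono {z : σ} {Λ Λ' : ℕ} (h : Λ' ≤ Λ) {R : MvPolynomial σ K}
    (hR : ∀ d ∈ R.support, Λ + d z ≤ d.degree) : ∀ d ∈ R.support, Λ' + d z ≤ d.degree :=
  fun d hd => le_trans (Nat.add_le_add_right h _) (hR d hd)

omit [Fintype σ] in
/-- Far parts: sums. [folklore] -/
theorem far_add {z : σ} {Λ : ℕ} {R R' : MvPolynomial σ K} (hR : ∀ d ∈ R.support, Λ + d z ≤ d.degree)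
    (hR' : ∀ d ∈ R'.support, Λ + d z ≤ d.degree) : ∀ d ∈ (R + R').support, Λ + d z ≤ d.degree := by
  classical
  intro d hd
  rcases Finset.mem_union.mp (support_add hd) with h | h
  · exact hR d h
  · exact hR' d h

omit [Fintype σ] in
/-- Far parts: finite sums. [folklore] -/
theorem far_sum {z : σ} {Λ : ℕ} {β : Type*} (B : Finset β) (g : β → MvPolynomial σ K)
    (h : ∀ b ∈ B, ∀ d ∈ (g b).support, Λ + d z ≤ d.degree) :
    ∀ d ∈ (∑ b ∈ B, g b).support, Λ + d z ≤ d.degree := by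
  classical
  induction B using Finset.induction_on with
  | empty => intro d hd; simp at hd
  | insert b B hb ih =>
    rw [Finset.sum_insert hb]
    exact far_add (h b (Finset.mem_insert_self b B))
      (ih fun b' hb' => h b' (Finset.mem_insert_of_mem hb'))

omit [Fintype σ] [DecidableEq σ] in
/-- A `z`-free polynomial of order `≥ Λ` is far. [folklore] -/
theorem far_of_varFree {z : σ} {Λ : ℕ} {P : MvPolynomial σ K} (hP : (∀ μ ∈ P.support, μ z = 0))
    (hΛ : (Λ : ℕ∞) ≤ ordZero P) : ∀ d ∈ P.support, Λ + d z ≤ d.degree := by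
  intro d hd
  rw [hP d hd, add_zero]
  by_contra hlt
  exact (mem_support_iff.mp hd) ((natCast_le_ordZero_iff_forall_coeff P Λ).mp hΛ d (not_le.mp hlt))

omit [Fintype σ] [DecidableEq σ] in
/-- Multiples of a far polynomial (ideal form). [folklore] -/
theorem far_of_mem_span {z : σ} {Λ : ℕ} {r P : MvPolynomial σ K} (hr : ∀ d ∈ r.support, Λ + d z ≤ d.degree)
    (h : P ∈ Ideal.span {r}) : ∀ d ∈ P.support, Λ + d z ≤ d.degree := by
  obtain ⟨a, rfl⟩ := Ideal.mem_span_singleton'.mp h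
  exact far_mul hr a

end Steps

end Summit.ResolutionOfSingularities.ResolutionOfSingularities.Theorems.WallFrames
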